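import Summits.ValiantsHypothesis.ValiantsHypothesis.Theorems.GrenetZeonDualUnipotentThreeHalvesLongMassRankOneGeneral

/-!
# `GrenetZeon.DualUnipotentThreeHalves` (stmt-ValiantsHypothesis-24318), line `slow_core`, stub `stub_longMassSlowLawInv` ((c)):
# the rank-one row — COMMON TRIANGULARISER exposed, and the locus versus `IrreducibleInv` (calibration honesty)

Sequel of ✓ `…LongMassRankOneGeneral` (★★★ `relCert_of_rankOne_linearPart`: (c) with `c = 3` for every affine nilpotent pencil whose linear
coefficient matrices all have rank `≤ 1`).  Here: `exists_conj_upper_of_rankOne_linearPart` — ONE invertible `S` makes EVERY value `S⁻¹ N(x) S`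
upper triangular (the triangulariser of the proof, exposed by name); ★ `not_irreducibleInv_of_rankOne_linearPart` — for `m ≥ 2` such a pencil is
NOT `SlowCore.IrreducibleInv` (the first column of `S` spans a line invariant under every value).  So the rank-one row is a row for the
irreducibility-FREE form `LongMassSlowLawAll` of (c) (✓ `LongMassIrreducibilityFree.inv_iff_all`) and is DISJOINT from the stub's `IrreducibleInv`
hypothesis in every size `≥ 2`: the content of (c) lives on constituents with a coefficient matrix of rank `≥ 2`.

Honest framing: support lemma (`--supports stmt-ValiantsHypothesis-24318`); NOT progress on (c) `SlowCore.LongMassSlowLawInv`, which with S3,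
24318, 8062, VP ≠ VNP stays OPEN / NOT proved.  No sorry, no definitions, no named facts. [folklore]
-/

-- single-conjunct layout: Sub = Summit, duplicated namespace component intended (the name is mandated)
set_option linter.dupNamespace false
set_option autoImplicit false

noncomputable section

namespace Summit.ValiantsHypothesis.ValiantsHypothesis.Theorems.GrenetZeon.LongMassRankOne

open MvPolynomial Matrix
open scoped BigOperators
open Summit.ValiantsHypothesis.ValiantsHypothesis.Cruxes.TwoDimCoefficients.DimTwoCases (AffMat IsAffine)
open Summit.ValiantsHypothesis.ValiantsHypothesis.Theorems.GrenetZeon.SlowCore (RelCert)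
open Summit.ValiantsHypothesis.ValiantsHypothesis.Theorems.GrenetZeon.RadicalSplit (linPart linPart_pow_eq_zero)

variable {n m : ℕ}

/-! ## §1 The common triangulariser; §2 the locus is reducible -/

/-- ★ **THE COMMON TRIANGULARISER, exposed.**  Under the hypotheses of `relCert_of_rankOne_linearPart`, ONE invertible `S` makes EVERY value
`S⁻¹ N(x) S` upper triangular. [this file] -/
theorem exists_conj_upper_of_rankOne_linearPart (N : AffMat n m) (hN : IsAffine N) {H : ℕ} (hnil : N ^ H = 0)
    (u w : Fin n × Fin n → Fin m → ℂ) (hcoef : ∀ e i j, coeff (Finsupp.single e 1) (N i j) = u e i * w e j) :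
    ∃ S : Matrix (Fin m) (Fin m) ℂ, IsUnit S ∧
      ∀ (x : Fin n × Fin n → ℂ) (a b : Fin m), b < a → (S⁻¹ * N.map (eval x) * S) a b = 0 := by
  classical
  obtain ⟨A₀, hA₀⟩ : ∃ A₀ : Matrix (Fin m) (Fin m) ℂ, A₀ = Matrix.of fun i j => coeff 0 (N i j) := ⟨_, rfl⟩
  have hval := map_eval_eq_constPart_add N hN u w hcoef
  rw [← hA₀] at hval
  have hNm : N ^ m = 0 :=
    Summit.ValiantsHypothesis.ValiantsHypothesis.Theorems.GrenetZeon.SlowCore.pow_card_eq_zero_of_pow_eq_zero N hnil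
  have hA0val : N.map (eval 0) = A₀ := by
    rw [hval 0]; simp
  have hA : A₀ ^ m = 0 := by
    rw [← hA0val, ← Matrix.map_pow, hNm]; exact Matrix.map_zero _ (map_zero _)
  have hhom : ∀ (c : ℂ) (x : Fin n × Fin n → ℂ), (c • A₀ + ∑ e, x e • vecMulVec (u e) (w e)) ^ (H + m + 1) = 0 := by
    intro c x
    rw [pow_succ]
    by_cases hc : c = 0
    · have hlin : (∑ e, x e • vecMulVec (u e) (w e)) = linPart N x := by
        unfold linPart
        rw [hval x, hA0val, add_sub_cancel_left]
      rw [hc, zero_smul, zero_add, hlin, pow_add, linPart_pow_eq_zero N hN hNm x, Matrix.mul_zero, Matrix.zero_mul]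
    · have hscale : c • A₀ + ∑ e, x e • vecMulVec (u e) (w e) = c • N.map (eval fun e => c⁻¹ * x e) := by
        rw [hval, smul_add, Finset.smul_sum]
        congr 1
        refine Finset.sum_congr rfl fun e _ => ?_
        rw [smul_smul, mul_inv_cancel_left₀ hc]
      rw [hscale, smul_pow, ← Matrix.map_pow, pow_add N H m, hnil, Matrix.zero_mul, Matrix.map_zero _ (map_zero _), smul_zero,
        Matrix.zero_mul]
  obtain ⟨ℓ, hℓ⟩ := exists_levels_resolvent A₀ hA u w hhom
  set L : ℕ := Finset.univ.sup ℓ + 1 with hLdef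
  have hL : ∀ e, ℓ e < L := fun e => Nat.lt_succ_of_le (Finset.le_sup (f := ℓ) (Finset.mem_univ e))
  obtain ⟨S, hS, htri0, htri⟩ := exists_conj_upper_with_constPart hℓ hL
  refine ⟨S, hS, fun x a b hab => ?_⟩
  have hconj : S⁻¹ * N.map (eval x) * S = S⁻¹ * A₀ * S + ∑ e, x e • (S⁻¹ * vecMulVec (u e) (w e) * S) := by
    rw [hval x, Matrix.mul_add, Matrix.add_mul, Finset.mul_sum, Finset.sum_mul]
    congr 1
    refine Finset.sum_congr rfl fun e _ => ?_
    rw [Matrix.mul_smul, Matrix.smul_mul]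
  rw [hconj, Matrix.add_apply, Matrix.sum_apply, htri0 a b hab, zero_add]
  refine Finset.sum_eq_zero fun e _ => ?_
  rw [Matrix.smul_apply, htri e a b hab, smul_zero]

/-- ★ **THE ROW'S LOCUS NEVER MEETS THE STUB'S HYPOTHESIS (calibration honesty, by name).**  For `m ≥ 2`, an affine nilpotent pencil whose linear
coefficient matrices all have rank `≤ 1` is NOT `SlowCore.IrreducibleInv`: the first column of the common triangulariser spans a line invariant
under every value.  So `relCert_of_rankOne_linearPart` is a row for the irreducibility-FREE form `LongMassSlowLawAll` of (c); it says nothing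
about an `IrreducibleInv` constituent of size `≥ 2`. [this file] -/
theorem not_irreducibleInv_of_rankOne_linearPart (N : AffMat n m) (hN : IsAffine N) {H : ℕ} (hnil : N ^ H = 0)
    (u w : Fin n × Fin n → Fin m → ℂ) (hcoef : ∀ e i j, coeff (Finsupp.single e 1) (N i j) = u e i * w e j) (hm : 2 ≤ m) :
    ¬ Summit.ValiantsHypothesis.ValiantsHypothesis.Theorems.GrenetZeon.SlowCore.IrreducibleInv N := by
  classical
  obtain ⟨S, hS, hup⟩ := exists_conj_upper_of_rankOne_linearPart N hN hnil u w hcoef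
  obtain ⟨uS, huS⟩ := hS
  have hSinv : S⁻¹ * S = 1 := by rw [← huS, ← Matrix.coe_units_inv, ← Units.val_mul, inv_mul_cancel, Units.val_one]
  have hSinv' : S * S⁻¹ = 1 := by rw [← huS, ← Matrix.coe_units_inv, ← Units.val_mul, mul_inv_cancel, Units.val_one]
  set i₀ : Fin m := ⟨0, by omega⟩ with hi₀
  set v : Fin m → ℂ := S *ᵥ Pi.single i₀ 1 with hv
  -- `v ≠ 0`
  have hv0 : v ≠ 0 := by
    intro h
    have h1 : S⁻¹ *ᵥ v = Pi.single i₀ 1 := by rw [hv, Matrix.mulVec_mulVec, hSinv, Matrix.one_mulVec]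
    rw [h, Matrix.mulVec_zero] at h1
    have h2 := congrFun h1 i₀
    rw [Pi.zero_apply, Pi.single_eq_same] at h2
    exact zero_ne_one h2
  -- the line `ℂ v` is invariant under every value
  have hinv : ∀ x : Fin n × Fin n → ℂ, ∀ z ∈ (ℂ ∙ v), (N.map (MvPolynomial.eval x)).mulVec z ∈ (ℂ ∙ v) := by
    intro x z hz
    obtain ⟨t, rfl⟩ := Submodule.mem_span_singleton.mp hz
    rw [Matrix.mulVec_smul]
    refine Submodule.smul_mem _ _ ?_
    set T := S⁻¹ * N.map (eval x) * S with hT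
    have hNT : N.map (eval x) *ᵥ v = S *ᵥ (T *ᵥ Pi.single i₀ 1) := by
      rw [hv, hT, Matrix.mulVec_mulVec, Matrix.mulVec_mulVec, ← Matrix.mul_assoc, ← Matrix.mul_assoc, hSinv', Matrix.one_mul]
    have hcol : T *ᵥ Pi.single i₀ 1 = T i₀ i₀ • Pi.single i₀ 1 := by
      ext a
      rw [Matrix.mulVec_single_one, Pi.smul_apply]
      by_cases ha : a = i₀
      · rw [ha, Pi.single_eq_same, smul_eq_mul, mul_one]; rfl
      · have hlt : i₀ < a := by
          rw [Fin.lt_def]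
          have hne : (a : ℕ) ≠ (i₀ : ℕ) := fun h0 => ha (Fin.ext h0)
          have hi0 : (i₀ : ℕ) = 0 := by rw [hi₀]
          omega
        rw [Pi.single_eq_of_ne ha, smul_zero]
        exact hup x a i₀ hlt
    rw [hNT, hcol, Matrix.mulVec_smul]
    exact Submodule.smul_mem _ _ (Submodule.mem_span_singleton_self v)
  intro hirr
  rcases hirr (ℂ ∙ v) hinv with hbot | htop
  · exact hv0 ((Submodule.span_singleton_eq_bot).mp hbot)
  · have h1 : Module.finrank ℂ (ℂ ∙ v) = 1 := finrank_span_singleton hv0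
    rw [htop, finrank_top, Module.finrank_pi, Fintype.card_fin] at h1
    omega

end Summit.ValiantsHypothesis.ValiantsHypothesis.Theorems.GrenetZeon.LongMassRankOne

end
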